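import Summits.QuantumFields.YangMills.Theorems.BalabanUVNodesN11ChargedSepJunctionOfSolvable
import Literature.MathematicalPhysics.QuantumFieldTheory.Balaban1983to89.Node00.TorusCoverCubeMember
import Literature.MathematicalPhysics.QuantumFieldTheory.Balaban1983to89.B10Eq71TorusOverlap

/-!
# DAG node N11 — THE (7)-DATA ROW ON THE ITERATED AVERAGING FIBRE: print's separation read at scale `n`, the bonds of the (7)-plaquettes off `Λ_n`, the mixed (7) field
# collapsing to the datum under the fibre identity — `DataSmall7PTop` from the reading support's clauses + the top clause, and the charged junction REDUCED TO ITS TOP CLAUSE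

HEADER — WORK-UNIT METADATA.  Cell `pub-ymgap`, YM-PLAN Track A (HUMAN RULING D-0062), seat `pub-ymgap-dag-n11-d` (g13; R134 fan-out seat N11 [B14], strategy s2),
route `BalabanUVNodes`, item K1⁷ `StabilityBAtRecordR13SepCoPH` = stmt-QuantumFields-20542 (helper, `--kind proof --supports 20542 --as helper`, count-neutral).
[III] = [Balaban1988Convergent], [15] = [Balaban1985Variational], [6] = [Balaban1985RegularSpaces].  Over this seat's `…N11ChargedSepJunctionOfSolvable` ∕
`…SpaceTruncationChargedSep` (`sepJunctionCharged_of_top`, `suppOfRecord₁₃SepCoP`), `…N11Data7TopZeroOfRead` (p598397, the level-0 clause), node00-def-P11's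
`Node00/Record12BgRowMixed` ∕ `…TopDomain` (`Sect2.mixedField`, `Sect2.printedPlaqs`, `Sect2.DataSmall7PTop`), n07-e's `Node00/TorusCoverCubeMember`
(`cover_mem_of_within_of_seqSeparated`), n12-c's `B15Prop1DatumSmall7AtZSequence` (`cover_add_single_pow`), `B10Eq71TorusOverlap.toFine_eq_embIter`.

WHY THIS FILE (HANDOFF §g12 «NEXT DOOR», second half).  The junction row of the no-expansion 𝐓-step at charged separated indices asks, besides the top regularity
(a theorem from [15]-solvability, `…N11ChiTopRegularity`), for print's (7)-data `DataSmall7PTop … Wc` at EVERY configuration `Wc` of the reading support; its clauses at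
levels `m+1 ≥ 1` read the MIXED field `mixedField … (Wc (m+1)) (Wc m)` — `V̄ = avg(Wc m)` on the bonds off `Λ_{m+1}` — which no per-level hypothesis on `Wc` controls.
On the ITERATED AVERAGING FIBRE (`avg(Wc m) = Wc (m+1)` on `bondsIn (m+1) (Ω_{m+1})ᶜ`, where 11a's `𝐓` reads its operand for a.e. top-scale field —
`…N11TkIteratedFibreReading(Slot)`, this seat g13) the mixed field IS `Wc (m+1)` on every (7)-plaquette: a bond of a (7)-plaquette off `Λ_{m+1}` has both ends outside
`Γ_{m+1}` and not both inside `Ω_{m+2}` (the CONCORD range `plaqNoBondIn`), hence — by print's separation of admissible sequences, [6] (1.3)–(1.6), read one `T^{(m+1)}`-step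
at a time on the cover — both ends outside `Ω_{m+1}`.  So the (7)-data row follows from the reading support's own clauses, the top clause and separation: the junction's
second half is DISCHARGED on the fibre.

WHAT THIS FILE PROVES (0 `sorry`, 0 `def`; one private `shift_comm`).
* §1 `within_side_add_single_pow`, ★ `embIter_shift_mem_of_mem_succ` ∕ `embIter_mem_of_shift_mem_succ` — print's separation at scale `n` (`SeqSeparated M₁ s`, `1 ≤ M₁`,
  `1 ≤ n < k`): the centre of a `T^{(n)}`-neighbour of a site whose centre lies in `Ω_{n+1}` lies in `Ω_n`.
* §2 ★ `mem_bondsIn_compl_of_not_mem_bondsOf_genSet_mid` (levels `1 ≤ n < k`, separated) ∕ `…_top` (level `k`): a scale-`n` bond off `bondsOf Γ_n` with not both ends in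
  `Ω_{n+1}^{(n)}` belongs to `bondsIn n (Ω_n)ᶜ` — the image bond set of 11a's generation `n−1`, where the fibre identity lives.
* §3 ★ `plaqHol_mixedField_eq_of_fibre` ∕ ★★ `plaqSmallOn_printedPlaqs_mixedField_of_fibre` — on the (7)-plaquettes the mixed field has the datum's plaquette variables,
  so the level-`(m+1)` (7) clause is a clause on `Wc (m+1)` alone.
* §4 ★★★ `dataSmall7PTop_of_read_of_top_of_fibre` — `DataSmall7PTop (avOfRecord) s₀.Ω (suppDom Ω₁) k δ Wc` from: `s₀` separated, the reading support's clauses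
  (`readSelOfSeq … j (Ω_{j+1})ᶜ`, `j < k`), the top clause on `plaqsOf (genSet s₀.Ω k k)`, and the fibre identity; ★★★ `sepJunctionChargedFibre_of_top` —
  `…ChargedSep.sepJunctionCharged_of_top` ON THE ITERATED FIBRE with the (7)-data half DISCHARGED: the discharger owes the TOP clause only (which
  `…N11ChiTopRegularity.plaqSmallOn_genSet_top_of_chiSeqOfRecord_ne_zero_of_solvable` supplies from [15]-solvability at `2 ≤ cR`).
NEXT (this seat): the fibre editions of `…SpaceTruncationCharged(Sep)`'s faces (background proviso over the fibre support `{charged ∧ χ_k ≠ 0 ∧ lower regular ∧ trivial off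
the V-bonds ∧ fibre identity}`), keyed on `…TkIteratedFibreReadingSlot.sect2Slot_congr_on_fibre_ae_of_regOn`, and the junction-of-solvable face WITHOUT the `h7` row.

HONEST FRAMING.  Helper lane of K1⁷; lattice geometry and bookkeeping; nothing of Bałaban's is asserted (separation `SeqSeparated`, the reading clauses, the top clause and the
fibre identity are HYPOTHESES here).  N11 NOT discharged; K1⁷ NOT closed; counts unmoved (typed 28∕28 · discharged 5∕27).  One finite four-torus programme at fixed
`ε = L^{−K}` — NOT ℝ⁴, NOT OS, NOT a mass gap, NOT Clay.  No `sorry`, `axiom`, `def`, `instance`, `notation`.  Sources (SHAPE only): [15] (3),(7) p.278 L20–33; [6] (1.3)–(1.6)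
p.77; [III] (2.1)–(2.2) pp.254–255, (2.10) p.256, (2.17) p.257, (2.21) p.258, (2.28) p.259.
-/

noncomputable section

open MeasureTheory
open scoped BigOperators Matrix.Norms.L2Operator

namespace Summit.QuantumFields.YangMills.Theorems.BalabanUVNodesN11Data7OnFibre

open Literature.MathematicalPhysics.QuantumFieldTheory.Balaban1983to89 T4Continuum Node00
open B15DeterminingSets B8Eq17ClassAkV1 B10Eq42TorusConstraint
open B15Eq112TorusCover (cover lift cover_lift)
open B14DomainGeom (Pt Within)
open B14.Eq213MaximalDomains (side)
open B15Prop1DatumSmall7AtZSequence (cover_add_single_pow)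
open B10Eq71TorusOverlap (toFine_eq_embIter)
open BalabanUVNodesN11Data7TopZeroOfRead (plaqSmallOn_printedPlaqsTop_of_readSel_zero)

/-! ## §1  Print's separation of the sequence, read at scale `n`: a `T^{(n)}`-neighbour of a centre in `Ω_{n+1}` is a centre in `Ω_n` -/

section Separation

variable {P : Params} {D : ℕ → Set (Set (Site P 0))} {k : ℕ}

/-- A `T^{(n)}`-step on the cover stays within sup-distance `LⁿM₁·L = side L M₁ (n+1)` (indeed within `Lⁿ`). [cite: Balaban1985RegularSpaces, (1.3)–(1.4) p.77 (bookkeeping)] -/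
theorem within_side_add_single_pow {M₁ : ℕ} (hM₁ : 1 ≤ M₁) (n : ℕ) (x : Pt P.d) (μ : Fin P.d) :
    Within (side P.L M₁ (n + 1) : ℤ) (x + Pi.single μ ((P.L ^ n : ℕ) : ℤ)) x := by
  intro i
  simp only [Pi.add_apply, add_sub_cancel_left]
  have hle : ((P.L ^ n : ℕ) : ℤ) ≤ (side P.L M₁ (n + 1) : ℤ) := by
    have h1 : P.L ^ n ≤ side P.L M₁ (n + 1) := by
      unfold side
      calc P.L ^ n = P.L ^ n * 1 := (mul_one _).symm
        _ ≤ P.L ^ (n + 1) * M₁ := Nat.mul_le_mul (Nat.pow_le_pow_right P.L_pos (Nat.le_succ n)) hM₁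
    exact_mod_cast h1
  by_cases hi : i = μ
  · subst hi
    rw [Pi.single_eq_same, abs_of_nonneg (by positivity)]
    exact hle
  · rw [Pi.single_eq_of_ne hi, abs_zero]
    exact le_trans (by positivity) hle

/-- **PRINT'S SEPARATION AT SCALE `n`, forward step**: along a separated (2.18) index (`SeqSeparated M₁ s`, `1 ≤ M₁`, `1 ≤ n < k`), if the centre of `y ∈ T^{(n)}` lies in
`Ω_{n+1}` then the centre of `y + e_μ` lies in `Ω_n` — [6] (1.4) «dist(Ω_jᶜ, Ω_{j+1}) ≥ RM₁Lʲη» costs at least one `T^{(n)}`-step (`Lⁿ ≤ LⁿM₁·L`).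
[cite: Balaban1985RegularSpaces, (1.3)–(1.6) p.77; Balaban1988Convergent, (2.1) p.254, p.256] -/
theorem embIter_shift_mem_of_mem_succ {M₁ : ℕ} (hM₁ : 1 ≤ M₁) (s : B14.Eq218Concrete.Seq D k) (hsep : Sect2.SeqSeparated M₁ s)
    {n : ℕ} (hn : 1 ≤ n) (hnk : n < k) {y : Site P n} (hy : embIter n y ∈ s.Ω (n + 1)) (μ : Fin P.d) :
    embIter n (y.shift μ) ∈ s.Ω n := by
  have hx : cover P (lift P (embIter n y)) = embIter n y := cover_lift _
  rw [← cover_add_single_pow n hx μ]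
  exact cover_mem_of_within_of_seqSeparated hM₁ s hsep hn hnk (by rw [hx]; exact hy) (within_side_add_single_pow hM₁ n _ μ)

/-- **PRINT'S SEPARATION AT SCALE `n`, backward step**: if the centre of `y + e_μ` lies in `Ω_{n+1}` then the centre of `y` lies in `Ω_n` (`1 ≤ n < k`).
[cite: Balaban1985RegularSpaces, (1.3)–(1.6) p.77; Balaban1988Convergent, (2.1) p.254, p.256] -/
theorem embIter_mem_of_shift_mem_succ {M₁ : ℕ} (hM₁ : 1 ≤ M₁) (s : B14.Eq218Concrete.Seq D k) (hsep : Sect2.SeqSeparated M₁ s)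
    {n : ℕ} (hn : 1 ≤ n) (hnk : n < k) {y : Site P n} (μ : Fin P.d) (hy : embIter n (y.shift μ) ∈ s.Ω (n + 1)) :
    embIter n y ∈ s.Ω n := by
  have hx : cover P (lift P (embIter n y)) = embIter n y := cover_lift _
  have hz : cover P (lift P (embIter n y) + Pi.single μ ((P.L ^ n : ℕ) : ℤ)) = embIter n (y.shift μ) := cover_add_single_pow n hx μ
  rw [← hx]
  refine cover_mem_of_within_of_seqSeparated hM₁ s hsep hn hnk (by rw [hz]; exact hy) fun i => ?_
  rw [abs_sub_comm]
  exact within_side_add_single_pow hM₁ n _ μ i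

end Separation

/-! ## §2  A scale-`n` bond off `Λ_n = bondsOf Γ_n` with not both ends in `Ω_{n+1}` lies in `bondsIn n (Ω_n)ᶜ` -/

section Bonds

variable {P : Params} {D : ℕ → Set (Set (Site P 0))} {k : ℕ}

/-- **LEVELS `1 ≤ n < k`**: for a separated index, a `T^{(n)}`-bond neither of whose ends lies in `Γ_n = (Ω_n ∖ Ω_{n+1})^{(n)}` and whose ends are not BOTH in `Ω_{n+1}^{(n)}` has both
ends outside `Ω_n` — it belongs to `bondsIn n (Ω_n)ᶜ`, the image bond set of 11a's generation `n−1` (an end in `Ω_{n+1}` would force its neighbour into `Ω_n ∖ Ω_{n+1} ∪ Ω_{n+1}`,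
§1). [cite: Balaban1985Variational, (7) p.278 L26–33; Balaban1985RegularSpaces, (1.3)–(1.6) p.77; Balaban1988Convergent, (2.2) p.255] -/
theorem mem_bondsIn_compl_of_not_mem_bondsOf_genSet_mid {M₁ : ℕ} (hM₁ : 1 ≤ M₁) (s : B14.Eq218Concrete.Seq D k) (hsep : Sect2.SeqSeparated M₁ s)
    {n : ℕ} (hn : 1 ≤ n) (hnk : n < k) (b : PBond P n) (hb : b ∉ bondsOf (genSet s.Ω k n))
    (hno : ¬ (b.src ∈ pts n (s.Ω (n + 1)) ∧ b.src.shift b.dir ∈ pts n (s.Ω (n + 1)))) : b ∈ bondsIn n (s.Ω n)ᶜ := by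
  have hΓ : genSet s.Ω k n = pts n (s.Ω n \ s.Ω (n + 1)) := by
    show pts n (gammaRegion s.Ω k n) = _
    rw [gammaRegion_mid s.Ω hn hnk]
  have hsrc : ¬ (embIter n b.src ∈ s.Ω n ∧ embIter n b.src ∉ s.Ω (n + 1)) := fun h => hb (Or.inl (by rw [hΓ]; exact h))
  have htgt : ¬ (embIter n (b.src.shift b.dir) ∈ s.Ω n ∧ embIter n (b.src.shift b.dir) ∉ s.Ω (n + 1)) := fun h => hb (Or.inr (by rw [hΓ]; exact h))
  -- the source is not in `Ω_{n+1}`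
  have h1 : embIter n b.src ∉ s.Ω (n + 1) := by
    intro h
    have h2 : embIter n (b.src.shift b.dir) ∈ s.Ω n := embIter_shift_mem_of_mem_succ hM₁ s hsep hn hnk h b.dir
    have h3 : embIter n (b.src.shift b.dir) ∈ s.Ω (n + 1) := by
      by_contra h4
      exact htgt ⟨h2, h4⟩
    exact hno ⟨h, h3⟩
  -- the target is not in `Ω_{n+1}`
  have h2 : embIter n (b.src.shift b.dir) ∉ s.Ω (n + 1) := by
    intro h
    have h3 : embIter n b.src ∈ s.Ω n := embIter_mem_of_shift_mem_succ hM₁ s hsep hn hnk b.dir h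
    exact hsrc ⟨h3, h1⟩
  refine mem_bondsIn_iff.mpr ⟨?_, ?_⟩
  · rw [toFine_eq_embIter]
    exact fun h => hsrc ⟨h, h1⟩
  · rw [toFine_eq_embIter]
    exact fun h => htgt ⟨h, h2⟩

/-- **THE TOP LEVEL `n = k`**: a `T^{(k)}`-bond neither of whose ends lies in `Γ_k = Ω_k^{(k)}` belongs to `bondsIn k (Ω_k)ᶜ` (no separation needed).
[cite: Balaban1985Variational, (7) p.278 L26–33; Balaban1988Convergent, (2.2) p.255] -/
theorem mem_bondsIn_compl_of_not_mem_bondsOf_genSet_top (Ω : ℕ → Set (Site P 0)) (k : ℕ) (b : PBond P k) (hb : b ∉ bondsOf (genSet Ω k k)) :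
    b ∈ bondsIn k (Ω k)ᶜ := by
  have hΓ : genSet Ω k k = pts k (Ω k) := by
    show pts k (gammaRegion Ω k k) = _
    rw [gammaRegion_self Ω k]
  refine mem_bondsIn_iff.mpr ⟨?_, ?_⟩
  · rw [toFine_eq_embIter]
    exact fun h => hb (Or.inl (by rw [hΓ]; exact h))
  · rw [toFine_eq_embIter]
    exact fun h => hb (Or.inr (by rw [hΓ]; exact h))

end Bonds

/-! ## §3  On print's (7)-plaquettes the MIXED field has the plaquette variables of the datum, once `avg(W_m) = W_{m+1}` on `bondsIn (m+1) (Ω_{m+1})ᶜ` -/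

section Mixed

variable {P : Params} {G : Type*} [GaugeGroup G]

/-- Unit steps commute. [folklore] -/
private theorem shift_comm {j : ℕ} (x : Site P j) (μ ν : Fin P.d) : (x.shift μ).shift ν = (x.shift ν).shift μ := by
  funext κ
  by_cases hκν : κ = ν
  · subst hκν
    by_cases hκμ : κ = μ
    · subst hκμ; rfl
    · simp [Site.shift, Function.update_apply, hκμ]
  · by_cases hκμ : κ = μ
    · subst hκμ
      simp [Site.shift, Function.update_apply, hκν]
    · simp [Site.shift, Function.update_apply, hκμ, hκν]

/-- **★ THE MIXED (7) FIELD HAS THE DATUM'S PLAQUETTE VARIABLES ON THE (7)-PLAQUETTES, GIVEN THE FIBRE IDENTITY.**  Let `n = m+1`; suppose every scale-`n` bond off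
`Λ_n = bondsOf Γ_n` with not both ends in `Ω_{n+1}^{(n)}` lies in `bondsIn n (Ω_n)ᶜ` (`hoff`, §2), and `(av m).avg (W m) = W n` on `bondsIn n (Ω_n)ᶜ` (the FIBRE IDENTITY of
11a's kernel transport, a.e. — `…TkIteratedFibreReading`).  Then on every (7)-plaquette `p` (touching `Γ_n`, no bond inside `Ω_{n+1}`) the mixed field `V(∂p)` with `V̄` on the
bonds off `Λ_n` IS `W_n(∂p)`. [cite: Balaban1985Variational, (7) p.278 L20–33; Balaban1988Convergent, (2.2) p.255, (2.10) p.256, (2.21) p.258] -/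
theorem plaqHol_mixedField_eq_of_fibre (av : ∀ j, Averaging P j G) (Ω : ℕ → Set (Site P 0)) (k : ℕ) {m : ℕ}
    (hoff : ∀ b : PBond P (m + 1), b ∉ bondsOf (genSet Ω k (m + 1)) →
      ¬ (b.src ∈ pts (m + 1) (Ω (m + 1 + 1)) ∧ b.src.shift b.dir ∈ pts (m + 1) (Ω (m + 1 + 1))) → b ∈ bondsIn (m + 1) (Ω (m + 1))ᶜ)
    {Wn : GaugeField P (m + 1) G} {Wm : GaugeField P m G}
    (hfib : ∀ b : PBond P (m + 1), b ∈ bondsIn (m + 1) (Ω (m + 1))ᶜ → (av m).avg Wm b = Wn b)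
    {p : Plaq P (m + 1)} (hp : p ∈ Sect2.printedPlaqs Ω k (m + 1)) :
    GaugeField.plaqHol (Sect2.mixedField av (genSet Ω k (m + 1)) Wn Wm) p = GaugeField.plaqHol Wn p := by
  obtain ⟨-, h1, h2, h3, h4⟩ := hp
  -- each bond: on `Λ_n` by definition, off `Λ_n` by the fibre identity
  have key : ∀ b : PBond P (m + 1), ¬ (b.src ∈ pts (m + 1) (Ω (m + 1 + 1)) ∧ b.src.shift b.dir ∈ pts (m + 1) (Ω (m + 1 + 1))) →
      Sect2.mixedField av (genSet Ω k (m + 1)) Wn Wm b = Wn b := fun b hno => by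
    by_cases hb : b ∈ bondsOf (genSet Ω k (m + 1))
    · exact Sect2.mixedField_of_mem av Wn Wm hb
    · rw [Sect2.mixedField_of_not_mem av Wn Wm hb]
      exact hfib b (hoff b hb hno)
  refine plaqHol_eq_of_bond_eq p (key _ h1) (key _ h2) (key _ ?_) (key _ h4)
  show ¬ (p.src.shift p.ν ∈ _ ∧ (p.src.shift p.ν).shift p.μ ∈ _)
  rw [← shift_comm p.src p.μ p.ν]
  exact h3

/-- **★★ THE (7) CLAUSE AT LEVEL `m+1` ON THE FIBRE IS A CLAUSE ON THE DATUM `W_{m+1}` ALONE**: under §2's bond bookkeeping and the fibre identity, regularity of `W_{m+1}` on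
print's (7)-plaquettes gives regularity of the mixed (7) field there. [cite: Balaban1985Variational, (7) p.278; Balaban1988Convergent, (2.10) p.256, (2.21) p.258] -/
theorem plaqSmallOn_printedPlaqs_mixedField_of_fibre (av : ∀ j, Averaging P j G) (Ω : ℕ → Set (Site P 0)) (k : ℕ) {m : ℕ}
    (hoff : ∀ b : PBond P (m + 1), b ∉ bondsOf (genSet Ω k (m + 1)) →
      ¬ (b.src ∈ pts (m + 1) (Ω (m + 1 + 1)) ∧ b.src.shift b.dir ∈ pts (m + 1) (Ω (m + 1 + 1))) → b ∈ bondsIn (m + 1) (Ω (m + 1))ᶜ)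
    {Wn : GaugeField P (m + 1) G} {Wm : GaugeField P m G}
    (hfib : ∀ b : PBond P (m + 1), b ∈ bondsIn (m + 1) (Ω (m + 1))ᶜ → (av m).avg Wm b = Wn b) {δ : ℝ}
    (hreg : PlaqSmallOn (Sect2.printedPlaqs Ω k (m + 1)) δ Wn) :
    PlaqSmallOn (Sect2.printedPlaqs Ω k (m + 1)) δ (Sect2.mixedField av (genSet Ω k (m + 1)) Wn Wm) := fun p hp => by
  rw [plaqHol_mixedField_eq_of_fibre av Ω k hoff hfib hp]
  exact hreg p hp

end Mixed

/-! ## §4  At the record: the (7)-data row on the iterated fibre from the reading support's clauses, the top clause and separation; the fibre junction -/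

section Record

variable (F : T4Family) (N : ℕ) [NeZero N]

/-- **★★★ THE (7)-DATA ROW ON THE ITERATED FIBRE**: for a SEPARATED index `s₀` of length `k ≥ 1` (`1 ≤ M₁`) and a multi-scale configuration `Wc` carrying the reading
support's lower-scale clauses (scale `j < k` regular at `δ_j` on the plaquettes touching `readSelOfSeq … j (Ω_{j+1})ᶜ`), the TOP clause (`Wc k` regular at `δ_k` on the plaquettes
touching `Ω_k^{(k)}`), and the FIBRE IDENTITY `(avOfRecord j).avg (Wc j) = Wc (j+1)` on `bondsIn (j+1) (Ω_{j+1})ᶜ` (`j < k`), print's (7) holds for the top domain `suppDom(Ω₁)`: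
level `0` by p598397, level `m+1` because the mixed field there IS `Wc (m+1)` on the (7)-plaquettes (§3), which touch `Γ_{m+1}` = the level-`(m+1)` reading region (`m+1 < k`)
or `Ω_k^{(k)}` (`m+1 = k`). [cite: Balaban1985Variational, (3),(7) p.278; Balaban1985RegularSpaces, (1.3)–(1.6) p.77; Balaban1988Convergent, (2.2) p.255, (2.10) p.256, (2.21) p.258] -/
theorem dataSmall7PTop_of_read_of_top_of_fibre (ν : Stage7Numerics) (hM₁ : 1 ≤ ν.M₁) {M : ℕ} {g : ℕ → ℝ} (p : B12.RunParams) {k : ℕ} (hk : 1 ≤ k)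
    (s₀ : SeqOfRecord F ν M g p.K k) (hs : Sect2.SeqSeparated ν.M₁ s₀) (δ : ℕ → ℝ) (Wc : MSField (F.P p.K) (SU N))
    (hlow : ∀ j, j < k → PlaqSmallOn (plaqsOf (pts j (readSelOfSeq F p (suppDomOfRecord F ν p.K s₀.Ω) s₀.Ω j (s₀.Ω (j + 1))ᶜ))) (δ j) (Wc j))
    (htop : PlaqSmallOn (plaqsOf (genSet s₀.Ω k k)) (δ k) (Wc k))
    (hfib : ∀ j, j < k → ∀ b : PBond (F.P p.K) (j + 1), b ∈ bondsIn (j + 1) (s₀.Ω (j + 1))ᶜ → (avOfRecord F N p.K j).avg (Wc j) b = Wc (j + 1) b) :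
    Sect2.DataSmall7PTop (avOfRecord F N p.K) s₀.Ω (suppDomOfRecord F ν p.K s₀.Ω) k δ Wc := by
  refine ⟨plaqSmallOn_printedPlaqsTop_of_readSel_zero F ν hM₁ p s₀.Ω hk (hlow 0 hk), fun m hm => ?_⟩
  -- the datum `Wc (m+1)` is regular on the (7)-plaquettes: reading region for `m+1 < k`, top clause for `m+1 = k`
  have hreg : PlaqSmallOn (Sect2.printedPlaqs s₀.Ω k (m + 1)) (δ (m + 1)) (Wc (m + 1)) := by
    rcases Nat.lt_or_eq_of_le hm with hlt | heq
    · have h1 := hlow (m + 1) hlt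
      rw [readSelOfSeq_compl_eq_gammaRegion _ _ (Nat.succ_pos m) hlt] at h1
      exact fun q hq => h1 q (Sect2.printedPlaqs_subset_plaqsOf _ _ _ hq)
    · subst heq
      exact fun q hq => htop q (Sect2.printedPlaqs_subset_plaqsOf _ _ _ hq)
  refine plaqSmallOn_printedPlaqs_mixedField_of_fibre (avOfRecord F N p.K) s₀.Ω k (fun b hb hno => ?_) (hfib m hm) hreg
  rcases Nat.lt_or_eq_of_le hm with hlt | heq
  · exact mem_bondsIn_compl_of_not_mem_bondsOf_genSet_mid hM₁ s₀ hs (Nat.succ_pos m) hlt b hb hno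
  · subst heq
    exact mem_bondsIn_compl_of_not_mem_bondsOf_genSet_top s₀.Ω (m + 1) b hb

variable {F N}
variable (θ : Stage13HParams F N) (p : B12.RunParams)

/-- **★★★ THE CHARGED JUNCTION ON THE ITERATED FIBRE IS ITS TOP CLAUSE ALONE** (`1 ≤ k`, `1 ≤ M₁`; print's reading regions `readSelOfSeq (suppDom) s₀.Ω`, letter `θ.s2.cR`):
`…SpaceTruncationChargedSep.sepJunctionCharged_of_top` asked the discharger for the top regularity AND the (7)-data `DataSmall7PTop`; on the iterated fibre (`Wc j ≡ 1` off
`bondsIn j (Ω_{j+1})ᶜ`, `avg(Wc j) = Wc (j+1)` on `bondsIn (j+1) (Ω_{j+1})ᶜ`, `j < k`) the (7)-data half is a THEOREM (`dataSmall7PTop_of_read_of_top_of_fibre`), so the top clause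
«`χ_k(s₀)(Wc k) ≠ 0 ⇒ Wc k` is `cR·ε_k`-regular on the plaquettes touching `Ω_k^{(k)}`» suffices. [cite: Balaban1988Convergent, (2.2) p.255, (2.10) p.256, (2.17) p.257, (2.28) p.259; Balaban1985RegularSpaces, (1.3)–(1.6) p.77; Balaban1985Variational, (7) p.278] -/
theorem sepJunctionChargedFibre_of_top {k : ℕ} (hk : 1 ≤ k) (hM₁ : 1 ≤ θ.ν.M₁)
    (hTop : ∀ s₀ : SeqOfRecord F θ.ν θ.τ9.M (gOfRecord₁₃ F N θ.toStage13Params p) p.K k,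
      slotsOfRecord F N θ.ν θ.τ9 (EOfRecord₁₃ F N θ.toStage13Params) (wOfRecord₉ F N θ.toStage9Params) θ.ppSel p
        (gOfRecord₁₃ F N θ.toStage13Params p) k s₀ ≠ 0 → Sect2.SeqSeparated θ.ν.M₁ s₀ → ∀ Wc : MSField (F.P p.K) (SU N),
      chiSeqOfRecord F N θ.ν θ.τ9.M (gOfRecord₁₃ F N θ.toStage13Params p) p.K k s₀ (Wc k) ≠ 0 →
      (∀ j, j < k → PlaqSmallOn (plaqsOf (pts j (readSelOfSeq F p (suppDomOfRecord F θ.ν p.K s₀.Ω) s₀.Ω j (s₀.Ω (j + 1))ᶜ)))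
        (θ.s2.cR * epsOfRecord θ.ν (gOfRecord₁₃ F N θ.toStage13Params p) j) (Wc j)) →
      PlaqSmallOn (plaqsOf (genSet s₀.Ω k k)) (θ.s2.cR * epsOfRecord θ.ν (gOfRecord₁₃ F N θ.toStage13Params p) k) (Wc k)) :
    ∀ s₀ : SeqOfRecord F θ.ν θ.τ9.M (gOfRecord₁₃ F N θ.toStage13Params p) p.K k,
      slotsOfRecord F N θ.ν θ.τ9 (EOfRecord₁₃ F N θ.toStage13Params) (wOfRecord₉ F N θ.toStage9Params) θ.ppSel p
        (gOfRecord₁₃ F N θ.toStage13Params p) k s₀ ≠ 0 → Sect2.SeqSeparated θ.ν.M₁ s₀ → ∀ Wc : MSField (F.P p.K) (SU N),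
      chiSeqOfRecord F N θ.ν θ.τ9.M (gOfRecord₁₃ F N θ.toStage13Params p) p.K k s₀ (Wc k) ≠ 0 →
      (∀ j, j < k → PlaqSmallOn (plaqsOf (pts j (readSelOfSeq F p (suppDomOfRecord F θ.ν p.K s₀.Ω) s₀.Ω j (s₀.Ω (j + 1))ᶜ)))
        (θ.s2.cR * epsOfRecord θ.ν (gOfRecord₁₃ F N θ.toStage13Params p) j) (Wc j)) →
      (∀ j, j < k → ∀ b : PBond (F.P p.K) j, b ∉ bondsIn j (s₀.Ω (j + 1))ᶜ → Wc j b = 1) →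
      (∀ j, j < k → ∀ b : PBond (F.P p.K) (j + 1), b ∈ bondsIn (j + 1) (s₀.Ω (j + 1))ᶜ → (avOfRecord F N p.K j).avg (Wc j) b = Wc (j + 1) b) →
      Wc ∈ suppOfRecord₁₃SepCoP F N θ.toStage13Params p k s₀ := by
  intro s₀ hch hs Wc hχ hlow _ hfib
  have htop := hTop s₀ hch hs Wc hχ hlow
  refine (mem_suppOfRecord₁₃SepCoP_iff F N θ.toStage13Params p k s₀ Wc).mpr ⟨⟨?_, fun j h1 hj => ?_⟩, hs,
    dataSmall7PTop_of_read_of_top_of_fibre F N θ.ν hM₁ p hk s₀ hs _ Wc hlow htop hfib⟩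
  · have h0 := hlow 0 hk
    rw [readSelOfSeq_zero_compl, pts_zero] at h0
    exact h0
  · rcases Nat.lt_or_eq_of_le hj with hlt | rfl
    · have h1' := hlow j hlt
      rw [readSelOfSeq_compl_eq_gammaRegion _ _ h1 hlt] at h1'
      exact h1'
    · exact htop

end Record

end Summit.QuantumFields.YangMills.Theorems.BalabanUVNodesN11Data7OnFibre

end
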